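import Literature.NumberTheory.EllipticCurves.BinaryQuarticLocalSolubility
import Literature.MeasureTheory.Group.PadicPolynomialZeroSet
import Mathlib.MeasureTheory.Constructions.BorelSpace.Basic
import Mathlib.MeasureTheory.Measure.Lebesgue.Basic
import Mathlib.RingTheory.MvPolynomial.Basic
import HarnessLib

/-!
# The measure on the space `V_R = R⁵` of binary quartic forms; null loci `Δ = 0`, `I = 0`, `J = 0`

Topic `Literature/NumberTheory/EllipticCurves`; continues `BinaryQuarticLocalSolubility.lean` (the
topology of `V_R`, M. Bhargava, A. Shankar, *Binary quartic forms having bounded invariants, and the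
boundedness of the average rank of elliptic curves*, Ann. of Math. (2) 181 (2015) 191–242, §2).

Bhargava–Shankar measure subsets of `V_ℝ` by Lebesgue measure ("`Vol`", §2.3–2.4) and subsets of
`V_{ℤ_p}` by "the additive measure `μ_p` on `V_{ℤ_p}` normalized so that `μ_p(V_{ℤ_p}) = 1`" (§2.5 of
the held arXiv text `arXiv:1006.1002v2`; the `p`-adic densities `μ_p(S)` of Thm 2.11 and the local
integrals `∫_{V_{ℤ_p}} φ_p(f) df` of the sieve, Thm 2.21 of the published version). This file puts
the corresponding `MeasureSpace` structure on `BinaryQuartic R` — the Borel σ-algebra of the product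
topology and the push-forward of the product measure `volume` on `Fin 5 → R` along the coefficient
homeomorphism — and proves that the discriminant locus `{Δ = 0}` and the non-rigid loci `{I = 0}`,
`{J = 0}` are null in `V_{ℤ_p}` and in `V_ℝ` (the "closed set of measure zero" outside of which the
local weights of the `2`-Selmer sieve are locally constant, cf.
`BinaryQuartic.eventually_isSoluble_iff`).

## Contents (no named facts)

* `instMeasurableSpace`/`instBorelSpace` (Borel σ-algebra of `V_R`), `measurableEquivFin5`
  (`V_R ≃ᵐ R⁵`), `instMeasureSpace` (`volume := map equivFin5.symm volume`),
  `measurePreserving_measurableEquivFin5`, `volume_eq_volume_image_coeffs`, and the instances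
  `IsProbabilityMeasure` (e.g. `R = ℤ_p`: total mass `1`, as printed) / `SigmaFinite` (e.g. `R = ℝ`).
* `discPoly`, `IPoly`, `JPoly : MvPolynomial (Fin 5) ℤ` with `aeval f.coeffs discPoly = Δ(f)` etc.,
  all nonzero.
* `volume_setOf_aeval_eq_zero`: for a nonzero integral polynomial `P` in the coefficients,
  `{f ∈ V_R | P(f) = 0}` is null (from `Literature.MeasureTheory.Group.volume_zeroSet_mvPolynomial_eq_zero_of_fintype`);
  hence `volume_setOf_disc_eq_zero`, `volume_setOf_I_eq_zero`, `volume_setOf_J_eq_zero`,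
  `ae_disc_ne_zero`, specialised to `ℤ_p` (`padicInt_volume_setOf_disc_eq_zero`) and `ℝ`
  (`real_volume_setOf_disc_eq_zero`).

## References

* M. Bhargava, A. Shankar, Ann. of Math. (2) 181 (2015) 191–242 = arXiv:1006.1002, §2.3–2.5
  (volumes in `V_ℝ`, the normalised measure `μ_p` on `V_{ℤ_p}`), Prop. 5.9 of the arXiv v2 text
  (non-rigid curves `I = 0` or `J = 0` are negligible). [cite: BhargavaShankarAnnals2015, §2.5 (the measure μ_p on V_{ℤ_p}; arXiv:1006.1002v2 numbering)]
-/

noncomputable section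

open scoped Classical
open MeasureTheory TopologicalSpace MvPolynomial

namespace Literature.NumberTheory.EllipticCurves

namespace BinaryQuartic

/-! ## The Borel structure and the measure on `V_R` -/

section Borel

variable {R : Type*} [TopologicalSpace R]

/-- The Borel σ-algebra of `V_R = R⁵` (product topology). [folklore] -/
instance instMeasurableSpace : MeasurableSpace (BinaryQuartic R) := borel _

/-- `V_R` carries its Borel σ-algebra (by definition). [folklore] -/
instance instBorelSpace : BorelSpace (BinaryQuartic R) := ⟨rfl⟩

variable [MeasurableSpace R] [BorelSpace R] [SecondCountableTopology R]

/-- `V_R ≃ᵐ R⁵` by the coefficient vector. [folklore] -/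
def measurableEquivFin5 : BinaryQuartic R ≃ᵐ (Fin 5 → R) :=
  homeomorphFin5.toMeasurableEquiv

/-- The measurable equivalence is the coefficient map (definitional). [folklore] -/
@[simp] theorem measurableEquivFin5_apply (f : BinaryQuartic R) :
    measurableEquivFin5 f = f.coeffs := rfl

/-- The coefficient map is measurable. [folklore] -/
@[fun_prop]
theorem measurable_coeffs : Measurable (coeffs : BinaryQuartic R → Fin 5 → R) :=
  (measurableEquivFin5 (R := R)).measurable

end Borel

section Volume

variable {R : Type*} [TopologicalSpace R] [MeasureSpace R] [BorelSpace R] [SecondCountableTopology R]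

/-- The measure on `V_R`: the push-forward of the product measure `volume` on `R⁵` along
`R⁵ ≃ V_R` — for `R = ℝ` Lebesgue measure (Bhargava–Shankar's `Vol` on `V_ℝ`, §2.3), for `R = ℤ_p`
the normalised Haar measure `μ_p` on `V_{ℤ_p}` (§2.5: "`μ_p(V_{ℤ_p}) = 1`").
[cite: BhargavaShankarAnnals2015, §2.5 (μ_p on V_{ℤ_p}; arXiv:1006.1002v2 numbering)] -/
instance instMeasureSpace : MeasureSpace (BinaryQuartic R) :=
  ⟨Measure.map (measurableEquivFin5 (R := R)).symm volume⟩

/-- Unfolding the measure on `V_R`. [folklore] -/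
theorem volume_eq :
    (volume : Measure (BinaryQuartic R)) = Measure.map (measurableEquivFin5 (R := R)).symm volume :=
  rfl

/-- The coefficient map `V_R → R⁵` is measure preserving. [folklore] -/
theorem measurePreserving_measurableEquivFin5 :
    MeasurePreserving (measurableEquivFin5 (R := R)) volume volume := by
  refine ⟨(measurableEquivFin5 (R := R)).measurable, ?_⟩
  rw [volume_eq, MeasurableEquiv.map_map_symm]

/-- `R⁵ → V_R` is measure preserving. [folklore] -/
theorem measurePreserving_measurableEquivFin5_symm :
    MeasurePreserving (measurableEquivFin5 (R := R)).symm volume volume :=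
  ⟨(measurableEquivFin5 (R := R)).symm.measurable, rfl⟩

/-- The measure of a set of forms is the product measure of its set of coefficient vectors.
[folklore] -/
theorem volume_eq_volume_image_coeffs (s : Set (BinaryQuartic R)) :
    volume s = volume (coeffs '' s) := by
  rw [volume_eq, MeasurableEquiv.map_apply, ← MeasurableEquiv.image_symm,
    MeasurableEquiv.symm_symm]
  rfl

/-- For a probability measure on `R` (e.g. `ℤ_p`), `V_R` has total mass `1`
(`μ_p(V_{ℤ_p}) = 1`). [cite: BhargavaShankarAnnals2015, §2.5 (μ_p(V_{ℤ_p}) = 1; arXiv:1006.1002v2 numbering)] -/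
instance instIsProbabilityMeasure [IsProbabilityMeasure (volume : Measure R)] :
    IsProbabilityMeasure (volume : Measure (BinaryQuartic R)) := by
  rw [volume_eq]
  exact Measure.isProbabilityMeasure_map (measurableEquivFin5 (R := R)).symm.measurable.aemeasurable

/-- For a σ-finite measure on `R` (e.g. Lebesgue measure on `ℝ`), the measure on `V_R` is σ-finite.
[folklore] -/
instance instSigmaFinite [SigmaFinite (volume : Measure R)] :
    SigmaFinite (volume : Measure (BinaryQuartic R)) := by
  rw [volume_eq]
  exact (measurableEquivFin5 (R := R)).symm.sigmaFinite_map

end Volume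

/-! ## `Δ`, `I`, `J` as integral polynomials in the coefficients -/

section Polys

/-- The discriminant as a polynomial `Δ ∈ ℤ[a,b,c,d,e]` (variables `0,…,4` for `a,…,e`).
[cite: BhargavaShankarAnnals2015, §1.2 (discriminant formula)] -/
def discPoly : MvPolynomial (Fin 5) ℤ :=
  256 * X 0 ^ 3 * X 4 ^ 3 - 192 * X 0 ^ 2 * X 1 * X 3 * X 4 ^ 2 - 128 * X 0 ^ 2 * X 2 ^ 2 * X 4 ^ 2
    + 144 * X 0 ^ 2 * X 2 * X 3 ^ 2 * X 4 - 27 * X 0 ^ 2 * X 3 ^ 4 + 144 * X 0 * X 1 ^ 2 * X 2 * X 4 ^ 2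
    - 6 * X 0 * X 1 ^ 2 * X 3 ^ 2 * X 4 - 80 * X 0 * X 1 * X 2 ^ 2 * X 3 * X 4
    + 18 * X 0 * X 1 * X 2 * X 3 ^ 3 + 16 * X 0 * X 2 ^ 4 * X 4 - 4 * X 0 * X 2 ^ 3 * X 3 ^ 2
    - 27 * X 1 ^ 4 * X 4 ^ 2 + 18 * X 1 ^ 3 * X 2 * X 3 * X 4 - 4 * X 1 ^ 3 * X 3 ^ 3
    - 4 * X 1 ^ 2 * X 2 ^ 3 * X 4 + X 1 ^ 2 * X 2 ^ 2 * X 3 ^ 2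

/-- The invariant `I = 12ae − 3bd + c²` as a polynomial in `ℤ[a,b,c,d,e]`.
[cite: BhargavaShankarAnnals2015, §2 p. 8] -/
def IPoly : MvPolynomial (Fin 5) ℤ :=
  12 * X 0 * X 4 - 3 * X 1 * X 3 + X 2 ^ 2

/-- The invariant `J = 72ace + 9bcd − 27ad² − 27eb² − 2c³` as a polynomial in `ℤ[a,b,c,d,e]`.
[cite: BhargavaShankarAnnals2015, §2 p. 8] -/
def JPoly : MvPolynomial (Fin 5) ℤ :=
  72 * X 0 * X 2 * X 4 + 9 * X 1 * X 2 * X 3 - 27 * X 0 * X 3 ^ 2 - 27 * X 4 * X 1 ^ 2 - 2 * X 2 ^ 3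

variable {R : Type*} [CommRing R]

/-- `Δ(f)` is the value of `discPoly` at the coefficient vector of `f`. [folklore] -/
theorem aeval_coeffs_discPoly (f : BinaryQuartic R) : aeval f.coeffs discPoly = f.disc := by
  simp [discPoly, disc]

/-- `I(f)` is the value of `IPoly` at the coefficient vector of `f`. [folklore] -/
theorem aeval_coeffs_IPoly (f : BinaryQuartic R) : aeval f.coeffs IPoly = f.I := by
  simp [IPoly, I]

/-- `J(f)` is the value of `JPoly` at the coefficient vector of `f`. [folklore] -/
theorem aeval_coeffs_JPoly (f : BinaryQuartic R) : aeval f.coeffs JPoly = f.J := by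
  simp [JPoly, J]

/-- `discPoly ≠ 0` (`Δ(x⁴ + y⁴) = 256`). [folklore] -/
theorem discPoly_ne_zero : discPoly ≠ 0 := by
  intro h
  have := aeval_coeffs_discPoly (R := ℤ) ⟨1, 0, 0, 0, 1⟩
  rw [h, map_zero] at this
  norm_num [disc] at this

/-- `IPoly ≠ 0` (`I(x⁴ + y⁴) = 12`). [folklore] -/
theorem IPoly_ne_zero : IPoly ≠ 0 := by
  intro h
  have := aeval_coeffs_IPoly (R := ℤ) ⟨1, 0, 0, 0, 1⟩
  rw [h, map_zero] at this
  norm_num [I] at this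

/-- `JPoly ≠ 0` (`J(x⁴ + x²y² + y⁴) = 70`). [folklore] -/
theorem JPoly_ne_zero : JPoly ≠ 0 := by
  intro h
  have := aeval_coeffs_JPoly (R := ℤ) ⟨1, 0, 1, 0, 1⟩
  rw [h, map_zero] at this
  norm_num [J] at this

end Polys

/-! ## Null loci -/

section Null

variable {R : Type*} [CommRing R] [IsDomain R] [CharZero R] [TopologicalSpace R]
  [IsTopologicalRing R] [T2Space R] [SecondCountableTopology R] [MeasureSpace R] [BorelSpace R]
  [SigmaFinite (volume : Measure R)] [NullSingletonClass (volume : Measure R)]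

/-- **The zero locus in `V_R` of a nonzero integral polynomial in the coefficients is null** (for
`R` an integral domain of characteristic zero with an atomless σ-finite Borel measure, e.g. `ℝ`,
`ℤ_p`). [folklore] -/
theorem volume_setOf_aeval_eq_zero (P : MvPolynomial (Fin 5) ℤ) (hP : P ≠ 0) :
    volume {f : BinaryQuartic R | aeval f.coeffs P = 0} = 0 := by
  have hP' : MvPolynomial.map (Int.castRingHom R) P ≠ 0 := by
    intro h
    apply hP
    exact MvPolynomial.map_injective _ Int.cast_injective (by rw [h, map_zero])
  have h0 := Literature.MeasureTheory.Group.volume_zeroSet_mvPolynomial_eq_zero_of_fintype _ hP'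
  rw [volume_eq_volume_image_coeffs]
  convert h0 using 2
  ext x
  simp only [Set.mem_image, Set.mem_setOf_eq]
  constructor
  · rintro ⟨f, hf, rfl⟩
    rw [MvPolynomial.aeval_def, algebraMap_int_eq] at hf
    rwa [MvPolynomial.eval_map]
  · intro hx
    refine ⟨equivFin5.symm x, ?_, equivFin5.apply_symm_apply x⟩
    rw [MvPolynomial.eval_map] at hx
    rw [MvPolynomial.aeval_def, algebraMap_int_eq]
    convert hx using 2
    exact equivFin5.apply_symm_apply x

/-- **The discriminant locus `{Δ = 0} ⊂ V_R` is null.** [folklore] -/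
theorem volume_setOf_disc_eq_zero : volume {f : BinaryQuartic R | f.disc = 0} = 0 := by
  simpa only [aeval_coeffs_discPoly] using volume_setOf_aeval_eq_zero (R := R) discPoly discPoly_ne_zero

/-- **The locus `{I = 0} ⊂ V_R` is null.** [folklore] -/
theorem volume_setOf_I_eq_zero : volume {f : BinaryQuartic R | f.I = 0} = 0 := by
  simpa only [aeval_coeffs_IPoly] using volume_setOf_aeval_eq_zero (R := R) IPoly IPoly_ne_zero

/-- **The locus `{J = 0} ⊂ V_R` is null.** [folklore] -/
theorem volume_setOf_J_eq_zero : volume {f : BinaryQuartic R | f.J = 0} = 0 := by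
  simpa only [aeval_coeffs_JPoly] using volume_setOf_aeval_eq_zero (R := R) JPoly JPoly_ne_zero

/-- Almost every form has nonzero discriminant. [folklore] -/
theorem ae_disc_ne_zero : ∀ᵐ f : BinaryQuartic R ∂volume, f.disc ≠ 0 := by
  rw [ae_iff]
  simpa using volume_setOf_disc_eq_zero (R := R)

/-- Almost every form is rigid with nonzero discriminant: `I ≠ 0`, `J ≠ 0`, `Δ ≠ 0`. [folklore] -/
theorem ae_I_ne_zero_and_J_ne_zero_and_disc_ne_zero :
    ∀ᵐ f : BinaryQuartic R ∂volume, f.I ≠ 0 ∧ f.J ≠ 0 ∧ f.disc ≠ 0 := by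
  have hI : ∀ᵐ f : BinaryQuartic R ∂volume, f.I ≠ 0 := by
    rw [ae_iff]; simpa using volume_setOf_I_eq_zero (R := R)
  have hJ : ∀ᵐ f : BinaryQuartic R ∂volume, f.J ≠ 0 := by
    rw [ae_iff]; simpa using volume_setOf_J_eq_zero (R := R)
  filter_upwards [hI, hJ, ae_disc_ne_zero (R := R)] with f h1 h2 h3
  exact ⟨h1, h2, h3⟩

end Null

/-! ## The two cases `R = ℤ_p` and `R = ℝ` -/

/-- **`{Δ = 0} ⊂ V_{ℤ_p}` is `μ_p`-null**, `μ_p` the normalised Haar measure on `V_{ℤ_p} = ℤ_p⁵`.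
[cite: BhargavaShankarAnnals2015, §2.5 (μ_p on V_{ℤ_p}; arXiv:1006.1002v2 numbering)] -/
theorem padicInt_volume_setOf_disc_eq_zero (p : ℕ) [Fact p.Prime] :
    volume {f : BinaryQuartic ℤ_[p] | f.disc = 0} = 0 :=
  volume_setOf_disc_eq_zero

/-- `μ_p(V_{ℤ_p}) = 1`. [cite: BhargavaShankarAnnals2015, §2.5 (μ_p(V_{ℤ_p}) = 1; arXiv:1006.1002v2 numbering)] -/
theorem padicInt_volume_univ (p : ℕ) [Fact p.Prime] :
    volume (Set.univ : Set (BinaryQuartic ℤ_[p])) = 1 :=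
  measure_univ

/-- Off a `μ_p`-null closed set, `ℚ_p`-solubility is locally constant on `V_{ℤ_p}`: the set of forms
at which it fails to be locally constant is contained in the closed null set `{Δ = 0}`
(`BinaryQuartic.eventually_isSoluble_iff`, `padicInt_volume_setOf_disc_eq_zero`). [folklore] -/
theorem padicInt_ae_eventually_isSoluble_iff (p : ℕ) [Fact p.Prime] :
    ∀ᵐ f : BinaryQuartic ℤ_[p] ∂volume, ∀ᶠ g in nhds f,
      (g.map PadicInt.Coe.ringHom).IsSoluble ↔ (f.map PadicInt.Coe.ringHom).IsSoluble := by
  filter_upwards [ae_disc_ne_zero (R := ℤ_[p])] with f hf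
  exact eventually_isSoluble_iff f hf

/-- **`{Δ = 0} ⊂ V_ℝ` is Lebesgue-null.** [folklore] -/
theorem real_volume_setOf_disc_eq_zero : volume {f : BinaryQuartic ℝ | f.disc = 0} = 0 :=
  volume_setOf_disc_eq_zero

end BinaryQuartic

end Literature.NumberTheory.EllipticCurves

end
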